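import Summits.QuantumAdvantage.QuantumAdvantage.Theorems.NearExactIsExact.Negative.CornerFlatRankFourFrameFree

/-!
# Corner-flat pairs of rank 4, IV-c: window pairs are quadratic on every fibre

Negative-side (disprover lane, unit `b2b-cforr-disprove-g33`, 2026-08-23) corollary of
`Negative/CornerFlatRankFourFrameFree.lean` for the crux `CubicForrelation.NearExactIsExact`.
`cff_window_sections_even_of_cubic` says that in a window pair (`Φ > 15/16`) of the cubic rank-4 corner-flat
habitat every section `{q : λ_J(corner(x,q)) = c}` of every fibre is `h`-even, for the coordinate-parity
functionals `λ_J`.  Here the last, linear-algebra step is taken: because the corner map of a fibre is injective,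
the columns `(u₁(x)_j, …, u₄(x)_j)` of the frame have trivial common kernel, hence (duality over `𝔽₂`,
`Submodule.span_eq_top_of_ne_zero`) the `λ_J` induce EVERY affine functional `q ↦ ω ⊕ ⟨β, q⟩` of the parameter
cube `𝔽₂⁴`.

* `cfq_span_realise` — columns with trivial common kernel realise every target functional.
* `cfq_frame_ker` — injectivity of the corner map gives the trivial common kernel.
* `cfq_window_cube_sections_even_of_cubic` — **in a window pair, `h ∘ corner(x, ·)` has even weight on all
  `32` affine sections `{q : ω ⊕ ⟨β,q⟩ = c}` of `𝔽₂⁴`** (every fibre `x`).  These are the parities pairing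
  `h ∘ corner(x, ·)` with `RM(1,4)`; all even means `h ∘ corner(x, ·) ∈ RM(1,4)^⊥ = RM(2,4)`: the dual `h` is
  QUADRATIC on every fibre, i.e. its cubic form vanishes on `V(x)³` for every `x` — the isotropy lemma of the
  `AMM₂` habitat with no frame hypothesis at all.

Standard three axioms only.
-/

set_option linter.dupNamespace false -- D-0017: single-problem summit ⇒ `QuantumAdvantage.QuantumAdvantage` by design

noncomputable section

namespace Summit.QuantumAdvantage.QuantumAdvantage.Theorems.NearExactIsExact.Negative.CornerFlatRankFour

open Finset
open Literature.Computability.QuantumComplexity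
open Summit.QuantumAdvantage.QuantumAdvantage.Theorems.NearExactIsExact.Negative.SkewProductCore (ind ind_and ind_xor
  ind_true ind_false decide_ind_eq_one ind_decide_eq_one)

variable {a m : ℕ}

section LinearAlgebra

/-! ### Duality over `𝔽₂` -/

/-- **Columns with trivial common kernel realise every functional.**  If the functionals
`z ↦ Σ_d cols_j(d)·z_d` (`j < m`) on `𝔽₂^ι` have no common nonzero kernel vector, then every target `τ` is a
combination of the columns: `Σ_j c_j cols_j = τ` (the functionals span the dual,
`Submodule.span_eq_top_of_ne_zero`). [folklore] -/
theorem cfq_span_realise {ι : Type*} [Fintype ι] [DecidableEq ι] (cols : Fin m → ι → ZMod 2)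
    (hker : ∀ z : ι → ZMod 2, (∀ j, (∑ d, cols j d * z d) = 0) → z = 0) (τ : ι → ZMod 2) :
    ∃ c : Fin m → ZMod 2, ∀ d, (∑ j, c j * cols j d) = τ d := by
  classical
  let F : Fin m → Module.Dual (ZMod 2) (ι → ZMod 2) := fun j => ∑ d, cols j d • LinearMap.proj d
  have hF : ∀ j z, F j z = ∑ d, cols j d * z d := by
    intro j z
    simp only [F, LinearMap.sum_apply, LinearMap.smul_apply, LinearMap.proj_apply, smul_eq_mul]
  have htop : Submodule.span (ZMod 2) (Set.range F) = ⊤ :=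
    Submodule.span_eq_top_of_ne_zero fun z hz => by
      by_contra hno
      push Not at hno
      exact hz (hker z fun j => by rw [← hF]; exact hno (F j) ⟨j, rfl⟩)
  let T : Module.Dual (ZMod 2) (ι → ZMod 2) := ∑ d, τ d • LinearMap.proj d
  have hT : ∀ z, T z = ∑ d, τ d * z d := by
    intro z
    simp only [T, LinearMap.sum_apply, LinearMap.smul_apply, LinearMap.proj_apply, smul_eq_mul]
  have hmem : T ∈ Submodule.span (ZMod 2) (Set.range F) := by
    rw [htop]
    exact Submodule.mem_top
  obtain ⟨c, hc⟩ := (Submodule.mem_span_range_iff_exists_fun (R := ZMod 2)).mp hmem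
  refine ⟨c, fun d => ?_⟩
  have key := LinearMap.congr_fun hc (Pi.single d 1)
  rw [LinearMap.sum_apply, hT] at key
  simpa only [LinearMap.smul_apply, smul_eq_mul, hF, Pi.single_apply, mul_ite, mul_one, mul_zero,
    Finset.sum_ite_eq', Finset.mem_univ, if_true] using key

/-- **Injective corner map ⇒ trivial common kernel of the frame columns**: if
`q ↦ w ⊕ q₁₁u₁ ⊕ q₁₂u₂ ⊕ q₂₁u₃ ⊕ q₂₂u₄` is injective then no nonzero `z ∈ 𝔽₂⁴` has
`z₀[u₁]_j + z₁[u₂]_j + z₂[u₃]_j + z₃[u₄]_j = 0` for all `j`. [folklore] -/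
theorem cfq_frame_ker (w u₁ u₂ u₃ u₄ : Fin m → Bool) (cx : (Bool × Bool) × (Bool × Bool) → (Fin m → Bool))
    (hc : ∀ q j, cx q j = (w j ^^ (q.1.1 && u₁ j) ^^ (q.1.2 && u₂ j) ^^ (q.2.1 && u₃ j) ^^ (q.2.2 && u₄ j)))
    (hinj : Function.Injective cx) (z : Fin 4 → ZMod 2)
    (hz : ∀ j, ind (u₁ j) * z 0 + ind (u₂ j) * z 1 + ind (u₃ j) * z 2 + ind (u₄ j) * z 3 = 0) : z = 0 := by
  have hii : ∀ b₁ b₂ : Bool, ind b₁ = ind b₂ → b₁ = b₂ := by decide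
  have hs : cx ((decide (z 0 = 1), decide (z 1 = 1)), (decide (z 2 = 1), decide (z 3 = 1))) =
      cx ((false, false), (false, false)) := by
    funext j
    refine hii _ _ ?_
    rw [hc, hc]
    simp only [ind_xor, ind_and, ind_decide_eq_one, Bool.false_and, ind_false, add_zero]
    linear_combination hz j
  have hq := hinj hs
  have hd : ∀ v : ZMod 2, decide (v = 1) = false → v = 0 := by decide
  funext d
  fin_cases d <;>
    first
    | exact hd _ (congrArg (fun q : (Bool × Bool) × (Bool × Bool) => q.1.1) hq)
    | exact hd _ (congrArg (fun q : (Bool × Bool) × (Bool × Bool) => q.1.2) hq)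
    | exact hd _ (congrArg (fun q : (Bool × Bool) × (Bool × Bool) => q.2.1) hq)
    | exact hd _ (congrArg (fun q : (Bool × Bool) × (Bool × Bool) => q.2.2) hq)

end LinearAlgebra

section Quadratic

/-! ### Window pairs: `h` is quadratic on every fibre -/

/-- **Window pairs are quadratic on every fibre.**  In the cubic rank-4 corner-flat habitat (`f(x₁‖x₂) =
l_{u₁}l_{u₂} ⊕ l_{u₃}l_{u₄} ⊕ l_w ⊕ f₀` cubic, `g` bent along `φ` with cubic dual `h`, corner map injective on
each fibre), `Φ(f,g) > 15/16` forces, for EVERY fibre `x₁` and EVERY affine functional `q ↦ ω ⊕ ⟨β,q⟩` of the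
parameter cube `𝔽₂⁴` (including `β = 0`), an even number of ones of `h ∘ corner(x₁,·)` on `{q : ω ⊕ ⟨β,q⟩ = c}`.
Equivalently `h ∘ corner(x₁,·) ⟂ RM(1,4)`, i.e. `h ∘ corner(x₁,·) ∈ RM(2,4)` is quadratic: the cubic form of `h`
vanishes identically on the fibre space `V(x₁) = ⟨u₁,u₂,u₃,u₄⟩(x₁)` — total isotropy, frame-free. [folklore] -/
theorem cfq_window_cube_sections_even_of_cubic
    (l : (Fin (a + 4) → Bool) → (Fin (a + 4) → Bool) → Bool) (hl : ∀ y x, signOf (l y x) = twist x y)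
    (u₁ u₂ u₃ u₄ w : (Fin a → Bool) → (Fin (a + 4) → Bool)) (f₀ : (Fin a → Bool) → Bool)
    (φ : (Fin (a + 4) → Bool) → (Fin a → Bool)) (h : (Fin (a + 4) → Bool) → Bool)
    (f g : (Fin (a + (a + 4)) → Bool) → Bool)
    (hf : ∀ x₁ x₂, f (Fin.append x₁ x₂) =
      ((l (u₁ x₁) x₂ && l (u₂ x₁) x₂) ^^ (l (u₃ x₁) x₂ && l (u₄ x₁) x₂) ^^ l (w x₁) x₂ ^^ f₀ x₁))
    (hg : ∀ (y₁ : Fin a → Bool) (y₂ : Fin (a + 4) → Bool),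
      signOf (g (Fin.append y₁ y₂)) = twist y₁ (φ y₂) * signOf (h y₂))
    (corner : (Fin a → Bool) → (Bool × Bool) × (Bool × Bool) → (Fin (a + 4) → Bool))
    (hc : ∀ x₁ q j, corner x₁ q j =
      (w x₁ j ^^ (q.1.1 && u₁ x₁ j) ^^ (q.1.2 && u₂ x₁ j) ^^ (q.2.1 && u₃ x₁ j) ^^ (q.2.2 && u₄ x₁ j)))
    (hφ : ∀ x₁ q, φ (corner x₁ q) = x₁) (hinj : ∀ x₁, Function.Injective (corner x₁))
    (hfc : IsDegLeFun 3 f) (hh : IsDegLeFun 3 h) (hwin : 15 / 16 < forrelation f g)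
    (x₁ : Fin a → Bool) (ω : Bool) (β : (Bool × Bool) × (Bool × Bool)) (c : Bool) :
    (∑ q ∈ univ.filter (fun q =>
        (ω ^^ (q.1.1 && β.1.1) ^^ (q.1.2 && β.1.2) ^^ (q.2.1 && β.2.1) ^^ (q.2.2 && β.2.2)) = c),
      ind (h (corner x₁ q))) = 0 := by
  classical
  -- the frame columns and their trivial common kernel
  let cols : Fin (a + 4) → Fin 4 → ZMod 2 := fun j =>
    ![ind (u₁ x₁ j), ind (u₂ x₁ j), ind (u₃ x₁ j), ind (u₄ x₁ j)]
  have hsum : ∀ (z : Fin 4 → ZMod 2) (j : Fin (a + 4)), (∑ d, cols j d * z d) =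
      ind (u₁ x₁ j) * z 0 + ind (u₂ x₁ j) * z 1 + ind (u₃ x₁ j) * z 2 + ind (u₄ x₁ j) * z 3 := by
    intro z j
    rw [Fin.sum_univ_four]
    rfl
  have hker : ∀ z : Fin 4 → ZMod 2, (∀ j, (∑ d, cols j d * z d) = 0) → z = 0 := fun z hz =>
    cfq_frame_ker (w x₁) (u₁ x₁) (u₂ x₁) (u₃ x₁) (u₄ x₁) (corner x₁) (hc x₁) (hinj x₁) z fun j => by
      rw [← hsum]
      exact hz j
  -- realise the target functional β by a coordinate-parity functional λ_J
  obtain ⟨cv, hcv⟩ := cfq_span_realise cols hker ![ind β.1.1, ind β.1.2, ind β.2.1, ind β.2.2]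
  have h01 : ∀ v y : ZMod 2, v * y = if v = 1 then y else 0 := by decide
  have hJ : ∀ u : Fin (a + 4) → Bool,
      (∑ j ∈ univ.filter (fun j => cv j = 1), ind (u j)) = ∑ j, cv j * ind (u j) := by
    intro u
    rw [sum_filter]
    exact sum_congr rfl fun j _ => (h01 (cv j) (ind (u j))).symm
  have hβ₁ : decide ((∑ j ∈ univ.filter (fun j => cv j = 1), ind (u₁ x₁ j)) = 1) = β.1.1 := by
    have e : (∑ j, cv j * ind (u₁ x₁ j)) = ind β.1.1 := hcv 0
    rw [hJ, e, decide_ind_eq_one]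
  have hβ₂ : decide ((∑ j ∈ univ.filter (fun j => cv j = 1), ind (u₂ x₁ j)) = 1) = β.1.2 := by
    have e : (∑ j, cv j * ind (u₂ x₁ j)) = ind β.1.2 := hcv 1
    rw [hJ, e, decide_ind_eq_one]
  have hβ₃ : decide ((∑ j ∈ univ.filter (fun j => cv j = 1), ind (u₃ x₁ j)) = 1) = β.2.1 := by
    have e : (∑ j, cv j * ind (u₃ x₁ j)) = ind β.2.1 := hcv 2
    rw [hJ, e, decide_ind_eq_one]
  have hβ₄ : decide ((∑ j ∈ univ.filter (fun j => cv j = 1), ind (u₄ x₁ j)) = 1) = β.2.2 := by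
    have e : (∑ j, cv j * ind (u₄ x₁ j)) = ind β.2.2 := hcv 3
    rw [hJ, e, decide_ind_eq_one]
  -- the λ_J-section is the β-section, up to the constant ω_J
  have hsec : ∀ q, decide ((∑ j ∈ univ.filter (fun j => cv j = 1), ind (corner x₁ q j)) = 1) =
      (decide ((∑ j ∈ univ.filter (fun j => cv j = 1), ind (w x₁ j)) = 1) ^^ (q.1.1 && β.1.1) ^^
        (q.1.2 && β.1.2) ^^ (q.2.1 && β.2.1) ^^ (q.2.2 && β.2.2)) := by
    intro q
    have key := cff_section_affine (univ.filter fun j => cv j = 1) (w x₁) (u₁ x₁) (u₂ x₁) (u₃ x₁) (u₄ x₁) q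
    rw [hβ₁, hβ₂, hβ₃, hβ₄] at key
    simpa only [hc] using key
  have hb : ∀ ωJ ω' c' t₁ t₂ t₃ t₄ : Bool,
      ((ωJ ^^ t₁ ^^ t₂ ^^ t₃ ^^ t₄) = (ωJ ^^ ω' ^^ c') ↔ (ω' ^^ t₁ ^^ t₂ ^^ t₃ ^^ t₄) = c') := by decide
  have key := cff_window_sections_even_of_cubic l hl u₁ u₂ u₃ u₄ w f₀ φ h f g hf hg corner hc hφ hinj hfc hh
    hwin x₁ (univ.filter fun j => cv j = 1)
    (decide ((∑ j ∈ univ.filter (fun j => cv j = 1), ind (w x₁ j)) = 1) ^^ ω ^^ c)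
  have hfilt : (univ.filter fun q => decide ((∑ j ∈ univ.filter (fun j => cv j = 1),
      ind (corner x₁ q j)) = 1) =
        (decide ((∑ j ∈ univ.filter (fun j => cv j = 1), ind (w x₁ j)) = 1) ^^ ω ^^ c)) =
      univ.filter fun q =>
        (ω ^^ (q.1.1 && β.1.1) ^^ (q.1.2 && β.1.2) ^^ (q.2.1 && β.2.1) ^^ (q.2.2 && β.2.2)) = c :=
    filter_congr fun q _ => by
      rw [hsec q]
      exact hb _ _ _ _ _ _ _
  rw [hfilt] at key
  exact key

end Quadratic

end Summit.QuantumAdvantage.QuantumAdvantage.Theorems.NearExactIsExact.Negative.CornerFlatRankFour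

end
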